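import Mathlib.NumberTheory.Padics.HeightOneSpectrum
import Mathlib.RingTheory.DedekindDomain.Dvr
import Mathlib.LinearAlgebra.FreeModule.IdealQuotient
import Mathlib.RingTheory.Localization.AtPrime.Basic
import Mathlib.NumberTheory.NumberField.Basic
import Literature.NumberTheory.EllipticCurves.CanonicalPAdicHeightLeavesProofs
import Literature.NumberTheory.EllipticCurves.TamagawaNeZeroProofs
import HarnessLib

/-!
# The canonical `p`-adic height: finite index of `E(ℚ) ∩ E₀(ℚ_ℓ)`, `E(ℚ) ∩ E₁(ℚ_p)`, and the
# step `E₁(ℚ₂) → E₂(ℚ₂)` (inputs for `WeierstrassCurve.exists_admissible_nsmul`)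

Trunk T-NT-EC (Literature/NumberTheory/EllipticCurves); fourth proof file behind
`CanonicalPAdicHeight.lean`, preparing the discharge of its named fact
`WeierstrassCurve.exists_admissible_nsmul` (every non-torsion `P ∈ E(ℚ)` has an ADMISSIBLE
multiple: in `E₁(ℚ_p)`, in the sigma disc, with non-singular reduction everywhere), which is
assembled in `CanonicalPAdicHeightAdmissibleProofs.lean`. The printed argument (Silverman, *AEC*,
2nd ed.): `E₀(ℚ_ℓ)`, `E₁(ℚ_ℓ)` are subgroups with `0 → E₁ → E₀ → Ẽ_ns(𝔽_ℓ) → 0` (VII.2.1,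
PDF p. 167), `E(K)/E₀(K)` is finite (VII.6.1–6.2, PDF p. 177; for a finite residue field "an easy
compactness argument", Exercise 7.6, PDF p. 181), `E₁(K) ≅ Ê(𝓜)` with `3v(x) = 2v(y)` (VII.2.2,
PDF p. 170), `Ê(𝓜ⁿ)/Ê(𝓜ⁿ⁺¹) ≅ 𝓜ⁿ/𝓜ⁿ⁺¹` (IV.3.2(a), PDF p. 116); so a multiple by the local
indices and (for `p = 2`) by `2` is admissible. This file PROVES the local inputs, inside `E(ℚ)`
with the local rings `ℤ_(ℓ) ⊂ ℚ` of the tree (`Literature.NumberTheory.EllipticCurves.localIntegers`,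
`WeierstrassCurve.localModel`, `nonsingularReductionSubgroupAt = E(ℚ) ∩ E₀(ℚ_ℓ)`,
`kernelOfReductionAt = E(ℚ) ∩ E₁(ℚ_p)` of `CanonicalPAdicHeightParallelogramProofs.lean`):

* `Literature.NumberTheory.EllipticCurves.localIntegers_eq_valuationSubringAtPrime` — `ℤ_(ℓ)` is
  Mathlib's `valuationSubringAtPrime ℚ v` for the place `v ↔ ℓ` of `𝓞 ℚ`
  (`Rat.HeightOneSpectrum.primesEquiv`, `valuation_equiv_padicValuation`), hence a discrete
  valuation ring (`IsLocalization.AtPrime.isDiscreteValuationRing_of_dedekind_domain`) with finite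
  residue field `𝓞 ℚ ⧸ v` (`IsLocalization.AtPrime.equivQuotMaximalIdeal`);
* `WeierstrassCurve.index_ne_zero_of_forall_one_lt_norm` — every subgroup of `E(ℚ)` containing the
  rational points of `E₁(ℚ_ℓ)` has FINITE INDEX: the tree's uniform pigeonhole form of the
  compactness argument, `WeierstrassCurve.index_ne_zero_of_forall_some_mem`
  (`TamagawaNeZeroProofs.lean`, AEC Exercise 7.6), for the local model over `ℤ_(ℓ)`; in particular
  `E(ℚ) ∩ E₀(ℚ_ℓ)` and `E(ℚ) ∩ E₁(ℚ_p)` have finite index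
  (`index_nonsingularReductionSubgroupAt_ne_zero`, `index_kernelOfReductionAt_ne_zero`) — the parts
  of AEC VII.6.2 and VII.2.1 that the argument uses;
* `WeierstrassCurve.exists_finset_forall_hasNonsingularReductionAt` — a rational point reduces
  non-singularly away from the finitely many primes dividing a non-vanishing partial derivative;
* the step `E₁(ℚ₂) → E₂(ℚ₂)` by an explicit `2`-adic estimate on the duplication formula (in place
  of the formal group): for `Q = (x, y) ∈ E(ℚ) ∩ E₁(ℚ₂)` with `Q ≠ -Q`, `‖x(2Q)‖₂ ≥ 4‖x‖₂`
  (`four_mul_padicNorm_le_padicNorm_addX`: the tangent slope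
  `λ = (3x² + 2a₂x + a₄ - a₁y)/(2y + a₁x + a₃)` has `‖λ‖₂² ≥ 4‖x‖₂` because `‖y‖² = ‖x‖³ ≥ 4‖x‖²`
  and `‖2‖₂ = ½`, and `x(2Q) = λ² + a₁λ - a₂ - 2x` has norm `‖λ‖²`), and `‖x‖₂ ≥ 16` puts
  `z = -x/y` in the sigma disc: `‖z‖₂ = ‖x‖₂^{-1/2} ≤ ¼ < ½ = 2^{-1/(2-1)}` (`inSigmaDisc_two_of_le`).

## Sources

* J. H. Silverman, *The Arithmetic of Elliptic Curves*, 2nd ed., GTM 106 (2009): VII.2.1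
  (PDF p. 167), VII.2.2 (PDF p. 170), VII.6.1, Cor. VII.6.2 (PDF p. 177), Exercise 7.6 (PDF p. 181),
  IV.3.2(a) (PDF p. 116) (held copy `book:silverman2009-arithmetic-elliptic-curves-2nd-ed`).
  [SilvermanAEC2009]

## Design notes

* Only theorems; no new definitions or instances. The discrete-valuation-ring and
  finite-residue-field structures on `ℤ_(ℓ)` are produced inside the proof by rewriting along the
  equality of valuation subrings `localIntegers ℓ = valuationSubringAtPrime ℚ v` (both are
  `ValuationSubring ℚ`), so that Mathlib's instances for the localisation apply verbatim.
* The generic files are elaborated with the classical `DecidableEq ℚ` instance, `E(ℚ)` in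
  `CanonicalPAdicHeight.lean` with `Rat`'s; `index_ne_zero_of_forall_one_lt_norm` is stated for an
  arbitrary instance and reduced to the classical one by `Subsingleton.elim` (cf. `point_add_irrel`).
* The `2`-adic estimate is carried out with Mathlib's `padicNorm 2 : ℚ → ℚ` (no casts into `ℚ₂`);
  `‖y‖² = ‖x‖³`, `‖y‖ < ‖x‖²`, `‖x‖ ≥ p²` on `E₁` are the tree's `v_X_lt_v_Y_of_one_lt`,
  `v_Y_lt_v_X_sq_of_one_lt`, `sq_le_norm_of_one_lt_norm`.
-/
noncomputable section

open scoped Classical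
open IsDedekindDomain NumberField

namespace Literature.NumberTheory.EllipticCurves

variable (ℓ : ℕ) [Fact ℓ.Prime]

/-- **`ℤ_(ℓ)` is the localisation of `𝓞 ℚ` at the place above `ℓ`**: the valuation ring
`localIntegers ℓ = {q | ‖q‖_ℓ ≤ 1}` of `ℚ` equals Mathlib's `valuationSubringAtPrime ℚ v` for the
height-one prime `v = primesEquiv⁻¹ ℓ` of `𝓞 ℚ` (the `v`-adic valuation is equivalent to
`Rat.padicValuation ℓ`, Mathlib `Rat.HeightOneSpectrum.valuation_equiv_padicValuation`, and
equivalent valuations have the same ring). [folklore] -/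
theorem localIntegers_eq_valuationSubringAtPrime :
    localIntegers ℓ = HeightOneSpectrum.valuationSubringAtPrime ℚ
      (Rat.HeightOneSpectrum.primesEquiv.symm (⟨ℓ, Fact.out⟩ : Nat.Primes) :
        HeightOneSpectrum (𝓞 ℚ)) := by
  rw [HeightOneSpectrum.valuationSubringAtPrime_eq_valuationSubring,
    localIntegers_eq_padicValuation_valuationSubring]
  have h := Rat.HeightOneSpectrum.valuation_equiv_padicValuation
    (Rat.HeightOneSpectrum.primesEquiv.symm (⟨ℓ, Fact.out⟩ : Nat.Primes) : HeightOneSpectrum (𝓞 ℚ))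
  have h' : ((Rat.HeightOneSpectrum.primesEquiv.symm (⟨ℓ, Fact.out⟩ : Nat.Primes) :
      HeightOneSpectrum (𝓞 ℚ)).valuation ℚ).IsEquiv (Rat.padicValuation ℓ) := by
    convert h using 2; simp
  exact ((Valuation.isEquiv_iff_valuationSubring _ _).mp h').symm

end Literature.NumberTheory.EllipticCurves

namespace WeierstrassCurve

open Literature.NumberTheory.EllipticCurves

/-! ### Finite index of the subgroups `E(ℚ) ∩ E₀(ℚ_ℓ)` and `E(ℚ) ∩ E₁(ℚ_p)` -/

section Index

variable (W : WeierstrassCurve ℚ) [W.IsIntegral ℤ] [W.IsElliptic] (ℓ : ℕ) [Fact ℓ.Prime]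

/-- **A subgroup of `E(ℚ)` containing `E(ℚ) ∩ E₁(ℚ_ℓ) ∖ {O}` has finite index** (`W` a `ℤ`-integral
equation of an elliptic curve): `ℤ_(ℓ)` is a discrete valuation ring with finite residue field
`𝔽_ℓ` (as the localisation `valuationSubringAtPrime` of `𝓞 ℚ`), so the uniform pigeonhole
argument `index_ne_zero_of_forall_some_mem` (Silverman's compactness argument for the finiteness
of `E(K)/E₀(K)`, AEC Exercise 7.6) applies to the local model `W.localModel ℓ`. Stated for an
arbitrary `DecidableEq ℚ` instance behind the group law (the generic files use the classical one,
`E(ℚ)` uses `Rat`'s; any two agree, `Subsingleton.elim`).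
[cite: SilvermanAEC2009, VII.6 Cor. 6.2 and Exercise 7.6 (PDF pp. 177, 181)] -/
theorem index_ne_zero_of_forall_one_lt_norm {d : DecidableEq ℚ}
    (H : @AddSubgroup W.toAffine.Point (@AddCommGroup.toAddGroup _
      (@WeierstrassCurve.Affine.Point.instAddCommGroup ℚ _ W.toAffine d)))
    (hH : ∀ (x y : ℚ) (h : W.toAffine.Nonsingular x y), 1 < ‖(x : ℚ_[ℓ])‖ →
      Affine.Point.some x y h ∈ H) :
    @AddSubgroup.index _ (@AddCommGroup.toAddGroup _
      (@WeierstrassCurve.Affine.Point.instAddCommGroup ℚ _ W.toAffine d)) H ≠ 0 := by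
  have hd : d = fun a b => Classical.propDecidable (a = b) := Subsingleton.elim _ _
  subst hd
  -- the place of `𝓞 ℚ` above `ℓ` and the structure of `ℤ_(ℓ)`
  set v : HeightOneSpectrum (𝓞 ℚ) :=
    Rat.HeightOneSpectrum.primesEquiv.symm (⟨ℓ, Fact.out⟩ : Nat.Primes) with hv
  have hA : localIntegers ℓ = HeightOneSpectrum.valuationSubringAtPrime ℚ v :=
    localIntegers_eq_valuationSubringAtPrime ℓ
  haveI : Finite (IsLocalRing.ResidueField (localIntegers ℓ)) := by
    rw [hA]
    haveI : Finite (𝓞 ℚ ⧸ v.asIdeal) := Ideal.finiteQuotientOfFreeOfNeBot _ v.ne_bot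
    exact Finite.of_equiv _ (IsLocalization.AtPrime.equivQuotMaximalIdeal v.asIdeal
      (HeightOneSpectrum.valuationSubringAtPrime ℚ v)).toEquiv
  haveI : IsDiscreteValuationRing (localIntegers ℓ) := by
    rw [hA]
    exact IsLocalization.AtPrime.isDiscreteValuationRing_of_dedekind_domain (𝓞 ℚ) v.ne_bot _
  -- `Δ ≠ 0` for the local model, and the kernel of reduction in coordinates
  have hΔ : (W.localModel ℓ).Δ ≠ 0 := fun h0 => W.Δ'.ne_zero (by
    rw [coe_Δ', ← W.baseChange_localModel ℓ, baseChange, map_Δ, h0, map_zero])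
  refine index_ne_zero_of_forall_some_mem (K := ℚ) (W.localModel ℓ) hΔ H fun x y h hx => ?_
  exact hH x y h ((not_mem_localIntegers_iff ℓ x).mp fun hxA => hx ⟨⟨x, hxA⟩, rfl⟩)

/-- **`E(ℚ) ∩ E₀(ℚ_ℓ)` has finite index in `E(ℚ)`** — the part of the finiteness of
`E(ℚ_ℓ)/E₀(ℚ_ℓ)` (Kodaira–Néron; Silverman AEC VII.6.1, Cor. VII.6.2) seen by the rational points.
[cite: SilvermanAEC2009, VII.6 Cor. 6.2 (PDF p. 177)] -/
theorem index_nonsingularReductionSubgroupAt_ne_zero :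
    (W.nonsingularReductionSubgroupAt ℓ).index ≠ 0 :=
  W.index_ne_zero_of_forall_one_lt_norm ℓ _ fun x _ h hx =>
    (mem_nonsingularReductionSubgroupAt_iff _).mpr
      ((W.reducesNonsingularlyAt_some ℓ h).mpr (Or.inl ((one_lt_norm_ratCast_iff ℓ x).mp hx)))

/-- **`E(ℚ) ∩ E₁(ℚ_p)` has finite index in `E(ℚ)`** — the part of `[E(ℚ_p) : E₁(ℚ_p)] =
c_p · #Ẽ_ns(𝔽_p) < ∞` (Silverman AEC VII.2.1 with VII.6.2) seen by the rational points.
[cite: SilvermanAEC2009, VII.2 Prop. 2.1 (PDF p. 167)] -/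
theorem index_kernelOfReductionAt_ne_zero : (W.kernelOfReductionAt ℓ).index ≠ 0 :=
  W.index_ne_zero_of_forall_one_lt_norm ℓ _ fun _ _ h hx =>
    (some_mem_kernelOfReductionAt_iff h).mpr hx

end Index

/-! ### Affine points, and the finitely many bad primes of a rational point -/

section Points

variable {W : WeierstrassCurve ℚ}

/-- A point of infinite order is an affine point. [folklore] -/
theorem exists_eq_some_of_not_isOfFinAddOrder {P : W.toAffine.Point} (hP : ¬ IsOfFinAddOrder P) :
    ∃ (x y : ℚ) (h : W.toAffine.Nonsingular x y), P = .some x y h := by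
  rcases P with _ | ⟨x, y, h⟩
  · exact (hP IsOfFinAddOrder.zero).elim
  · exact ⟨x, y, h, rfl⟩

/-- **A rational point reduces non-singularly at almost all primes**: away from the finitely many
primes dividing the numerator or the denominator of a non-vanishing partial derivative `Φ_x(x, y)`
or `Φ_y(x, y)` (one of them is non-zero at a non-singular point), that derivative is an `ℓ`-adic
unit, which is `HasNonsingularReductionAt`. [Silverman AEC VII.2 (definition of `E₀`)] [folklore] -/
theorem exists_finset_forall_hasNonsingularReductionAt {x y : ℚ} (h : W.toAffine.Nonsingular x y) :
    ∃ S : Finset ℕ, ∀ ℓ : ℕ, ℓ.Prime → ℓ ∉ S → W.HasNonsingularReductionAt ℓ x y := by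
  obtain ⟨q, hq0, hq⟩ : ∃ q : ℚ, q ≠ 0 ∧
      ∀ ℓ : ℕ, padicValRat ℓ q = 0 → W.HasNonsingularReductionAt ℓ x y := by
    rcases h.2 with hX | hY
    · exact ⟨_, hX, fun ℓ hv => Or.inr (Or.inl ⟨hX, hv⟩)⟩
    · exact ⟨_, hY, fun ℓ hv => Or.inr (Or.inr ⟨hY, hv⟩)⟩
  refine ⟨(q.num.natAbs * q.den).primeFactors, fun ℓ hℓ hS => hq ℓ ?_⟩
  have hn : q.num.natAbs * q.den ≠ 0 :=
    Nat.mul_ne_zero (Int.natAbs_ne_zero.mpr (Rat.num_ne_zero.mpr hq0)) q.den_nz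
  have hndvd : ¬ ℓ ∣ q.num.natAbs * q.den := fun hd => hS (Nat.mem_primeFactors.mpr ⟨hℓ, hd, hn⟩)
  haveI := Fact.mk hℓ
  rw [padicValRat, padicValInt.eq_zero_of_not_dvd, padicValNat.eq_zero_of_not_dvd]
  · simp
  · exact fun hd => hndvd (dvd_mul_of_dvd_right hd _)
  · rw [Int.natCast_dvd]
    exact fun hd => hndvd (dvd_mul_of_dvd_left hd _)

end Points
section Two

variable (W : WeierstrassCurve ℚ) [W.IsIntegral ℤ]

/-! ### The step `E₁(ℚ₂) → E₂(ℚ₂)`: a `2`-adic estimate on the duplication formula -/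

variable {W} in
/-- **Norms of the coordinates of a rational point of `E₁(ℚ_p)`** (`ℤ`-integral equation),
`padicNorm` form of the tree's valuation lemmas: `‖y‖_p² = ‖x‖_p³` (`3v(x) = 2v(y)`),
`‖y‖_p < ‖x‖_p²`, and `‖x‖_p ≥ p²`. [Silverman AEC VII.2.2 (PDF p. 170: "`3v(x) = 2v(y)`")]
[folklore] -/
theorem padicNorm_Y_of_one_lt (p : ℕ) [Fact p.Prime] {x y : ℚ} (h : W.toAffine.Nonsingular x y)
    (hx : 1 < padicNorm p x) :
    padicNorm p y ^ 2 = padicNorm p x ^ 3 ∧ padicNorm p y < padicNorm p x ^ 2 ∧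
      (p : ℚ) ^ 2 ≤ padicNorm p x := by
  have hv := integers_localIntegers p
  have h1 : ((W.localModel p).baseChange ℚ).toAffine.Equation x y := h.1
  have hxR : 1 < ‖(x : ℚ_[p])‖ := by rw [Padic.eq_padicNorm]; exact_mod_cast hx
  have hx' : 1 < ratAdicValuation p x := by
    rw [ratAdicValuation_apply, ← NNReal.coe_lt_coe, NNReal.coe_one, coe_nnnorm]; exact hxR
  obtain ⟨-, hsq⟩ := v_X_lt_v_Y_of_one_lt hv h1 hx'
  have hlt := v_Y_lt_v_X_sq_of_one_lt hv h1 hx'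
  have hsqR : ‖(y : ℚ_[p])‖ ^ 2 = ‖(x : ℚ_[p])‖ ^ 3 := by
    have := congrArg (fun t : NNReal => (t : ℝ)) hsq
    simpa only [ratAdicValuation_apply, NNReal.coe_pow, coe_nnnorm] using this
  have hltR : ‖(y : ℚ_[p])‖ < ‖(x : ℚ_[p])‖ ^ 2 := by
    rw [ratAdicValuation_apply, ratAdicValuation_apply, ← NNReal.coe_lt_coe, NNReal.coe_pow,
      coe_nnnorm, coe_nnnorm] at hlt
    exact hlt
  have h4 := sq_le_norm_of_one_lt_norm h hxR
  rw [Padic.eq_padicNorm, Padic.eq_padicNorm] at hsqR hltR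
  rw [Padic.eq_padicNorm] at h4
  exact ⟨by exact_mod_cast hsqR, by exact_mod_cast hltR, by exact_mod_cast h4⟩

variable {W} in
/-- **Doubling moves `E₁(ℚ₂)` into `E₂(ℚ₂)`, quantitatively**: for a `ℤ`-integral equation and a
rational point `Q = (x, y)` with `‖x‖₂ > 1` and `Q ≠ -Q`, the `x`-coordinate of `2Q` satisfies
`‖x(2Q)‖₂ ≥ 4‖x‖₂`. With `N = ‖x‖₂ ≥ 4`, `Y = ‖y‖₂`, `Y² = N³`: the numerator
`3x² + 2a₂x + a₄ - a₁y` of the tangent slope `λ` has norm `N²` (`‖3‖₂ = 1`, `Y < N²`), the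
denominator `2y + a₁x + a₃` has norm `≤ Y/2` (`‖2‖₂ = ½`, `N ≤ Y/2`), so `‖λ‖ Y ≥ 2N²`,
`‖λ‖² ≥ 4N⁴/Y² = 4N > ‖a₁λ - a₂ - 2x‖`, and `x(2Q) = λ² + a₁λ - a₂ - 2x` has norm `‖λ‖²`. This is
the case `n ≥ 1` of `[2] Ê(2ⁿℤ₂) ⊆ Ê(2ⁿ⁺¹ℤ₂)` (AEC IV.3.2(a): `Ê(𝓜ⁿ)/Ê(𝓜ⁿ⁺¹) ≅ 𝓜ⁿ/𝓜ⁿ⁺¹`, killed by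
`2`), made explicit on the Weierstrass duplication formula.
[Silverman AEC IV.3.2(a) (PDF p. 116), VII.2.2 (PDF p. 170), III.2.3 (duplication formula)]
[folklore] -/
theorem four_mul_padicNorm_le_padicNorm_addX {x y : ℚ} (h : W.toAffine.Nonsingular x y)
    (hx : 1 < padicNorm 2 x) (hy : y ≠ W.toAffine.negY x y) :
    4 * padicNorm 2 x ≤ padicNorm 2 (W.toAffine.addX x x (W.toAffine.slope x x y y)) := by
  obtain ⟨hsq, hylt, hN4⟩ := padicNorm_Y_of_one_lt 2 h hx
  norm_num at hN4
  have hN0 : 0 < padicNorm 2 x := by linarith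
  have hY0 : 0 ≤ padicNorm 2 y := padicNorm.nonneg _
  have hY2N : 2 * padicNorm 2 x ≤ padicNorm 2 y := by
    nlinarith [mul_nonneg (mul_nonneg hN0.le hN0.le) (sub_nonneg.mpr hN4)]
  have hYpos : 0 < padicNorm 2 y := by linarith
  -- integrality of the coefficients, `|2| = 1/2`, `|3| = 1`
  have ha₁ : padicNorm 2 W.a₁ ≤ 1 := by rw [← integralModel_a₁_eq ℤ W]; exact padicNorm.of_int _
  have ha₂ : padicNorm 2 W.a₂ ≤ 1 := by rw [← integralModel_a₂_eq ℤ W]; exact padicNorm.of_int _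
  have ha₃ : padicNorm 2 W.a₃ ≤ 1 := by rw [← integralModel_a₃_eq ℤ W]; exact padicNorm.of_int _
  have ha₄ : padicNorm 2 W.a₄ ≤ 1 := by rw [← integralModel_a₄_eq ℤ W]; exact padicNorm.of_int _
  have h2 : padicNorm 2 (2 : ℚ) = 2⁻¹ := by
    have := padicNorm.padicNorm_p_of_prime (p := 2); exact_mod_cast this
  have h3 : padicNorm 2 (3 : ℚ) = 1 := by
    have := (padicNorm.nat_eq_one_iff (p := 2) 3).mpr (by norm_num); exact_mod_cast this
  have hn0 := fun q : ℚ => padicNorm.nonneg (p := 2) q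
  -- the numerator of the tangent slope has norm `|x|²`
  have hν : padicNorm 2 (3 * x ^ 2 + 2 * W.a₂ * x + W.a₄ - W.a₁ * y) = padicNorm 2 x ^ 2 := by
    have hmain : padicNorm 2 (3 * x ^ 2) = padicNorm 2 x ^ 2 := by
      rw [padicNorm.mul, IsAbsoluteValue.abv_pow (padicNorm 2), h3, one_mul]
    have t1 : padicNorm 2 (2 * W.a₂ * x) < padicNorm 2 x ^ 2 := by
      rw [padicNorm.mul, padicNorm.mul, h2]
      calc 2⁻¹ * padicNorm 2 W.a₂ * padicNorm 2 x ≤ 2⁻¹ * 1 * padicNorm 2 x := by gcongr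
        _ < padicNorm 2 x ^ 2 := by nlinarith
    have t2 : padicNorm 2 W.a₄ < padicNorm 2 x ^ 2 := by nlinarith
    have t3 : padicNorm 2 (W.a₁ * y) < padicNorm 2 x ^ 2 := by
      rw [padicNorm.mul]
      calc padicNorm 2 W.a₁ * padicNorm 2 y ≤ 1 * padicNorm 2 y := by gcongr
        _ = padicNorm 2 y := one_mul _
        _ < padicNorm 2 x ^ 2 := hylt
    have hrest : padicNorm 2 (2 * W.a₂ * x + W.a₄ - W.a₁ * y) < padicNorm 2 x ^ 2 :=
      lt_of_le_of_lt padicNorm.sub (max_lt (lt_of_le_of_lt padicNorm.nonarchimedean (max_lt t1 t2)) t3)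
    have e : 3 * x ^ 2 + 2 * W.a₂ * x + W.a₄ - W.a₁ * y =
        3 * x ^ 2 + (2 * W.a₂ * x + W.a₄ - W.a₁ * y) := by ring
    rw [e, padicNorm.add_eq_max_of_ne (by rw [hmain]; exact hrest.ne'), hmain, max_eq_left hrest.le]
  -- the denominator `2y + a₁x + a₃` has norm `≤ |y|/2`
  have hδ : padicNorm 2 (y - W.toAffine.negY x y) ≤ padicNorm 2 y / 2 := by
    have e : y - W.toAffine.negY x y = 2 * y + W.a₁ * x + W.a₃ := by
      rw [WeierstrassCurve.Affine.negY]; ring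
    rw [e]
    have t1 : padicNorm 2 (2 * y) ≤ padicNorm 2 y / 2 := by rw [padicNorm.mul, h2]; linarith
    have t2 : padicNorm 2 (W.a₁ * x) ≤ padicNorm 2 y / 2 := by
      rw [padicNorm.mul]
      calc padicNorm 2 W.a₁ * padicNorm 2 x ≤ 1 * padicNorm 2 x := by gcongr
        _ ≤ padicNorm 2 y / 2 := by linarith
    have t3 : padicNorm 2 W.a₃ ≤ padicNorm 2 y / 2 := by linarith
    exact padicNorm.nonarchimedean.trans (max_le (padicNorm.nonarchimedean.trans (max_le t1 t2)) t3)
  have hδ0 : y - W.toAffine.negY x y ≠ 0 := sub_ne_zero.mpr hy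
  have hδpos : 0 < padicNorm 2 (y - W.toAffine.negY x y) :=
    lt_of_le_of_ne (hn0 _) (padicNorm.nonzero hδ0).symm
  -- the slope
  have hL : padicNorm 2 (W.toAffine.slope x x y y) * padicNorm 2 (y - W.toAffine.negY x y) =
      padicNorm 2 x ^ 2 := by
    rw [W.toAffine.slope_of_Y_ne rfl hy, padicNorm.div, hν, div_mul_cancel₀ _ hδpos.ne']
  have hLY : 2 * padicNorm 2 x ^ 2 ≤ padicNorm 2 (W.toAffine.slope x x y y) * padicNorm 2 y := by
    nlinarith [hn0 (W.toAffine.slope x x y y)]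
  have hL2 : 4 * padicNorm 2 x ≤ padicNorm 2 (W.toAffine.slope x x y y) ^ 2 := by
    -- `L² Y² ≥ 4 N⁴ = 4 N Y²`
    have h1 : (2 * padicNorm 2 x ^ 2) ^ 2 ≤ (padicNorm 2 (W.toAffine.slope x x y y) * padicNorm 2 y) ^ 2 :=
      pow_le_pow_left₀ (by positivity) hLY 2
    have h2' : (padicNorm 2 (W.toAffine.slope x x y y) * padicNorm 2 y) ^ 2 =
        padicNorm 2 (W.toAffine.slope x x y y) ^ 2 * padicNorm 2 x ^ 3 := by rw [mul_pow, hsq]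
    rw [h2'] at h1
    have hx3 : 0 < padicNorm 2 x ^ 3 := by positivity
    nlinarith
  have hL1 : 1 < padicNorm 2 (W.toAffine.slope x x y y) := by nlinarith [hn0 (W.toAffine.slope x x y y)]
  -- `x(2P) = λ² + a₁λ - a₂ - 2x` has norm `|λ|²`
  set L := W.toAffine.slope x x y y with hLdef
  have hmain : padicNorm 2 (L ^ 2) = padicNorm 2 L ^ 2 := IsAbsoluteValue.abv_pow (padicNorm 2) L 2
  have hLL : padicNorm 2 L < padicNorm 2 L ^ 2 := by nlinarith
  have t1 : padicNorm 2 (W.a₁ * L) < padicNorm 2 L ^ 2 := by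
    rw [padicNorm.mul]
    calc padicNorm 2 W.a₁ * padicNorm 2 L ≤ 1 * padicNorm 2 L := by gcongr
      _ = padicNorm 2 L := one_mul _
      _ < padicNorm 2 L ^ 2 := hLL
  have t2 : padicNorm 2 W.a₂ < padicNorm 2 L ^ 2 := by nlinarith
  have t3 : padicNorm 2 x < padicNorm 2 L ^ 2 := by nlinarith
  have hrest : padicNorm 2 (W.a₁ * L - W.a₂ - x - x) < padicNorm 2 L ^ 2 :=
    lt_of_le_of_lt padicNorm.sub (max_lt (lt_of_le_of_lt padicNorm.sub
      (max_lt (lt_of_le_of_lt padicNorm.sub (max_lt t1 t2)) t3)) t3)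
  have e : W.toAffine.addX x x L = L ^ 2 + (W.a₁ * L - W.a₂ - x - x) := by
    rw [WeierstrassCurve.Affine.addX]; ring
  rw [e, padicNorm.add_eq_max_of_ne (by rw [hmain]; exact hrest.ne'), hmain, max_eq_left hrest.le]
  exact hL2

variable {W} in
/-- **The sigma disc at `p = 2`**: a rational point `(x, y)` of a `ℤ`-integral equation with
`‖x‖₂ ≥ 16`, i.e. in `E₂(ℚ₂)`, has parameter `z = -x/y` with `‖z‖₂ ≤ ¼ < ½ = 2^{-1/(2-1)}`
(`‖z‖₂² ‖x‖₂ = 1`). [Silverman AEC VII.2.2 (PDF p. 170); Stein–Wuthrich 2013, §4 (range of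
convergence `ord_p(t) > 1/(p-1)` of `σ`)] [folklore] -/
theorem inSigmaDisc_two_of_le {x y : ℚ} (h : W.toAffine.Nonsingular x y) (hx : 16 ≤ padicNorm 2 x) :
    InSigmaDisc 2 (-(x : ℚ_[2]) / y) := by
  have hx1 : 1 < padicNorm 2 x := by linarith
  obtain ⟨hsq, -, -⟩ := padicNorm_Y_of_one_lt 2 h hx1
  have hn0 := fun q : ℚ => padicNorm.nonneg (p := 2) q
  have hy0 : 0 < padicNorm 2 y := by
    by_contra hle
    have h0 : padicNorm 2 y = 0 := le_antisymm (not_lt.mp hle) (hn0 y)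
    rw [h0] at hsq
    have : padicNorm 2 x ^ 3 = 0 := by rw [← hsq]; ring
    have := pow_eq_zero_iff (n := 3) three_ne_zero |>.mp this
    linarith
  have hz : padicNorm 2 (-x / y) ^ 2 * padicNorm 2 x = 1 := by
    rw [padicNorm.div, padicNorm.neg, div_pow, hsq]
    field_simp
  have hz' : padicNorm 2 (-x / y) ≤ 1 / 4 := by
    by_contra hlt
    rw [not_le] at hlt
    have : 1 / 16 < padicNorm 2 (-x / y) ^ 2 := by nlinarith
    nlinarith
  unfold InSigmaDisc
  rw [show (-(x : ℚ_[2]) / y) = ((-x / y : ℚ) : ℚ_[2]) by push_cast; rfl, Padic.eq_padicNorm]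
  have hrad : ((2 : ℕ) : ℝ) ^ (-(1 / (((2 : ℕ) : ℝ) - 1))) = 2⁻¹ := by
    rw [show (-(1 / (((2 : ℕ) : ℝ) - 1))) = (-1 : ℝ) by norm_num, Nat.cast_ofNat, Real.rpow_neg_one]
  rw [hrad]
  calc ((padicNorm 2 (-x / y) : ℚ) : ℝ) ≤ ((1 / 4 : ℚ) : ℝ) := Rat.cast_le.mpr hz'
    _ < 2⁻¹ := by norm_num

end Two

end WeierstrassCurve
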